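/-
Copyright (c) 2026. All rights reserved.
Released under Apache 2.0 license as described in the file LICENSE.
-/
import Literature.NumberTheory.Weil1964.ArchDualPairThetaMajorantsInrConj
import Literature.NumberTheory.Li1992.RallisDoubledPairCarriers
import Literature.NumberTheory.GelbartRogawski1991.CompatibleSplittingCM
import HarnessLib

/-!
# The DOUBLED CM dual pair `(U(diag d_V), U(W ⊕ W⁻))` at the rank-one pin: its compatible pair splitting READ AT THE
# DOUBLED GRAM MATRIX `𝕋`, with Weil's Lemme 5 for the conjugated `W□`-families

Topic `NumberTheory/Li1992`; namespace `Literature.NumberTheory.Li1992.DoubledPair` (the carriers of ★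
`RallisDoubledPairCarriers`: `TWD`, `eD`, `𝕋 = doubledGramFin F (adelicGram F e T_V T_W)`).  KERNEL mathematics only:
theorems, no definition, no cited statement as a hypothesis.

At the CM pin (`F = L⁺`, `E = L`, `c` = complex conjugation, `T_V = realDiagonal d_V`, `T_W = realDiagonal d_W`,
`d_W : Fin 1 → L`, `δ = imagUnit L`) the doubled line `W ⊕ W⁻` is the hermitian PLANE `diag(d_W 0, −d_W 0)`:
`realDiagonal L ![d_W 0, −d_W 0] = TWD L⁺ (realDiagonal L d_W)` (`realDiagonal_doubledLine`), so the doubled pair is a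
GR diagonal dual pair with `M = 2` and ★ `GRConstruction.compatibleSplitting_cmSplittingDatum` gives it a continuous
compatible pair splitting `s□` ([GelbartRogawski1991, Prop. 3.1.1]) — on the carriers
`adelicMpCont L⁺ (Fin (n+n)) (adelicGram L⁺ (eD N e) (realDiagonal d_V) (realDiagonal ![d_W 0, −d_W 0]))`, whose Gram
matrix EQUALS `𝕋` (`adelicGram_eD_doubledLine`, from ★ `adelicGram_eD_eq_doubledGramFin`) but is not syntactically `𝕋`.
This file transports `s□` to `𝕋` ONCE (by `subst` along a variable Gram matrix) and records what the Siegel–Weil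
boundedness assembly consumes ([Weil1965, Chap. V n° 47 Lemme 20, n° 50]; cell hodgecm-mathlib, crux item H413,
`Theorems/H413E2SWBorelBoundFrame` binder `hIMPL`):

* §1 the doubled-line identities and the carrier bridge `U(TWD)(𝔸) = U(diag ![d_W 0, −d_W 0])(𝔸)` (same subgroup of
  `GL₂(𝔸_L)`), with the compactness transfer to the subtype;
* §2 `toSp_congr_apply`: the pair embedding `toSp` depends on its Gram ∕ form indices only through their values
  (pointwise, by `subst`), so the two index conventions for the doubled pair agree on the common `GL`-element;
* §3–§4 **`exists_doubledPairSplitting`**: a homomorphism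
  `s' : U(diag d_V)(𝔸) × U(diag ![d_W 0, −d_W 0])(𝔸) →* Mp_ψ(𝕎□_𝔸)ᶜᵒⁿᵗ` AT `𝕋` with (i) the projection of
  `s'(1, u)` equal POINTWISE on `𝕎□_𝔸` to the pair embedding `toSp` of the doubled pair in the child line's
  conventions (`J = T.map ι`, `hJ := rfl`) at `1 ⊗ u` — no cast on the consumer's side; (ii) `u ↦ s'(1,u)`
  coefficient-continuous; (iii) **for every fixed `q ∈ Mp_ψ(𝕎□_𝔸)ᶜᵒⁿᵗ`, every `Φ` and every compact `C`, ONE real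
  non-negative `Φ₀ ∈ 𝒮(𝔸^{n+n})` dominating all `ω(q · s'(1,u) · q⁻¹)Φ`, `u ∈ C`** (★
  `Weil1964.exists_piSchwartzBruhat_dominating_conj_cmPairSplitting_inr_two` — Weil's Lemme 5 [Weil1964, Chap. III
  n° 41 p. 194] in the conjugated polarisation, no sign hypothesis).

HC_CM is proved only modulo the printed citations until rung 0 closes; nothing here is about Hodge classes.

## References
* [GelbartRogawski1991] S. Gelbart, J. Rogawski, Invent. Math. 105 (1991), §3.1 Prop. 3.1.1 p. 455.
* [GelbartPiatetskishapiroRallis1987] S. Gelbart, I. Piatetski-Shapiro, S. Rallis, LNM 1254 (1987), Part A §2 pp. 7–9.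
* [Weil1964] A. Weil, Acta Math. 111 (1964), Chap. III n° 41, Lemme 5 p. 194.
* [Weil1965] A. Weil, Acta Math. 113 (1965), Chap. V n° 47 Lemme 20, n° 50.
-/

set_option autoImplicit false

noncomputable section

namespace Literature.NumberTheory.Li1992.DoubledPair

open scoped Matrix
open NumberField IsDedekindDomain
open Literature.RepresentationTheory.HeisenbergGroup
open Literature.NumberTheory.Weil1964 Literature.NumberTheory.Automorphic
open Literature.NumberTheory.GelbartRogawski1991 Literature.NumberTheory.GelbartRogawski1991.UnitaryDualPair

section CMPin

variable (L : Type) [Field L] [NumberField L] [IsCMField L] {N n : ℕ} (e : Fin N × Fin 1 ≃ Fin n)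
  (dV : Fin N → L) (hdV : ∀ i, IsCMField.complexConj L (dV i) = dV i) (hdV0 : ∀ i, dV i ≠ 0)
  (dW : Fin 1 → L) (hdW : ∀ i, IsCMField.complexConj L (dW i) = dW i) (hdW0 : ∀ i, dW i ≠ 0)

/-! ## §1 The doubled line `![d_W 0, −d_W 0]` and the carrier bridge -/

include hdW in
/-- the entries of the doubled line are conjugation-fixed. [cite: GelbartPiatetskishapiroRallis1987, Part A §2 pp. 7–9] -/
theorem complexConj_doubledLine : ∀ i, IsCMField.complexConj L (![dW 0, -dW 0] i) = ![dW 0, -dW 0] i := by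
  intro i
  fin_cases i
  · exact hdW 0
  · show IsCMField.complexConj L (-dW 0) = -dW 0
    rw [map_neg, hdW 0]

omit [NumberField L] [IsCMField L] in
include hdW0 in
/-- the entries of the doubled line are non-zero. [cite: GelbartPiatetskishapiroRallis1987, Part A §2 pp. 7–9] -/
theorem doubledLine_ne_zero : ∀ i, ![dW 0, -dW 0] i ≠ 0 := by
  intro i
  fin_cases i
  · exact hdW0 0
  · exact neg_ne_zero.2 (hdW0 0)

/-- **`realDiagonal ![d_W 0, −d_W 0] = T_W ⊕ (−T_W)`** (`TWD` of ★ `RallisDoubledPairCarriers`) for `T_W = realDiagonal d_W`.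
[cite: GelbartPiatetskishapiroRallis1987, Part A §2 pp. 7–9] -/
theorem realDiagonal_doubledLine :
    realDiagonal L ![dW 0, -dW 0] (complexConj_doubledLine L dW hdW) =
      TWD (↥(maximalRealSubfield L)) (realDiagonal L dW hdW) := by
  ext i j
  fin_cases i <;> fin_cases j <;> rfl

/-- over `L`: `(T_W ⊕ (−T_W)) ⊗ L = diag(d_W 0, −d_W 0)`. [cite: GelbartPiatetskishapiroRallis1987, Part A §2 pp. 7–9] -/
theorem map_TWD_realDiagonal :
    (TWD (↥(maximalRealSubfield L)) (realDiagonal L dW hdW)).map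
        (algebraMap (↥(maximalRealSubfield L)) L) = Matrix.diagonal ![dW 0, -dW 0] := by
  rw [← realDiagonal_doubledLine L dW hdW, realDiagonal_map]

/-- **the two adelic Gram matrices coincide**: `adelicGram (eD) (diag d_V) (diag ![d_W 0, −d_W 0]) = 𝕋`.
[cite: GelbartPiatetskishapiroRallis1987, Part A §2 pp. 7–9] -/
theorem adelicGram_eD_doubledLine :
    adelicGram (↥(maximalRealSubfield L)) (eD N e) (realDiagonal L dV hdV)
        (realDiagonal L ![dW 0, -dW 0] (complexConj_doubledLine L dW hdW)) =
      doubledGramFin (↥(maximalRealSubfield L))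
        (adelicGram (↥(maximalRealSubfield L)) e (realDiagonal L dV hdV) (realDiagonal L dW hdW)) := by
  rw [realDiagonal_doubledLine]
  exact adelicGram_eD_eq_doubledGramFin (↥(maximalRealSubfield L)) N e (realDiagonal L dV hdV) (realDiagonal L dW hdW)

/-- **the carrier bridge**: the adelic unitary group of `T_W ⊕ (−T_W)` (the child line's `U_D`) IS the adelic unitary
group of `diag(d_W 0, −d_W 0)` — the same subgroup of `GL₂(𝔸_L)`. [cite: GelbartPiatetskishapiroRallis1987, Part A §2 pp. 7–9] -/
theorem adelic_TWD_eq :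
    UnitaryGroup.adelic (↥(maximalRealSubfield L)) L (IsCMField.complexConj L) (1 + 1)
        ((TWD (↥(maximalRealSubfield L)) (realDiagonal L dW hdW)).map (algebraMap (↥(maximalRealSubfield L)) L)) =
      UnitaryGroup.adelic (↥(maximalRealSubfield L)) L (IsCMField.complexConj L) 2 (Matrix.diagonal ![dW 0, -dW 0]) := by
  rw [map_TWD_realDiagonal]

/-- membership form of the bridge. [cite: GelbartPiatetskishapiroRallis1987, Part A §2 pp. 7–9] -/
theorem mem_adelic_TWD_iff (k : GL (Fin (1 + 1)) (AdeleRing (𝓞 L) L)) :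
    k ∈ UnitaryGroup.adelic (↥(maximalRealSubfield L)) L (IsCMField.complexConj L) (1 + 1)
        ((TWD (↥(maximalRealSubfield L)) (realDiagonal L dW hdW)).map (algebraMap (↥(maximalRealSubfield L)) L)) ↔
      k ∈ UnitaryGroup.adelic (↥(maximalRealSubfield L)) L (IsCMField.complexConj L) 2
        (Matrix.diagonal ![dW 0, -dW 0]) := by
  rw [adelic_TWD_eq]

/-- **compactness transfer**: a compact `C ⊆ GL₂(𝔸_L)` contained in `U_D` is compact as a subset of the subtype
`U(diag(d_W 0, −d_W 0))(𝔸)` (the two carriers of the doubled unitary group `U(W ⊕ W⁻)(𝔸)`).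
[cite: GelbartPiatetskishapiroRallis1987, Part A §2 pp. 7–9] -/
theorem isCompact_setOf_coe_mem {C : Set (GL (Fin (1 + 1)) (AdeleRing (𝓞 L) L))} (hC : IsCompact C)
    (hCU : C ⊆ UnitaryGroup.adelic (↥(maximalRealSubfield L)) L (IsCMField.complexConj L) (1 + 1)
      ((TWD (↥(maximalRealSubfield L)) (realDiagonal L dW hdW)).map (algebraMap (↥(maximalRealSubfield L)) L))) :
    IsCompact {u : ↥(UnitaryGroup.adelic (↥(maximalRealSubfield L)) L (IsCMField.complexConj L) 2
      (Matrix.diagonal ![dW 0, -dW 0])) | (u : GL (Fin (1 + 1)) (AdeleRing (𝓞 L) L)) ∈ C} := by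
  refine Topology.IsInducing.subtypeVal.isCompact_iff.2 ?_
  have himg : Subtype.val '' {u : ↥(UnitaryGroup.adelic (↥(maximalRealSubfield L)) L (IsCMField.complexConj L) 2
      (Matrix.diagonal ![dW 0, -dW 0])) | (u : GL (Fin (1 + 1)) (AdeleRing (𝓞 L) L)) ∈ C} = C := by
    ext k
    refine ⟨?_, fun hk => ⟨⟨k, (mem_adelic_TWD_iff L dW hdW k).1 (hCU hk)⟩, hk, rfl⟩⟩
    rintro ⟨u, hu, rfl⟩
    exact hu
  exact (congrArg IsCompact himg).mpr hC

end CMPin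

/-! ## §2 Index congruence of the pair embedding `toSp` -/

section Congr

variable (F E : Type) [Field F] [NumberField F] [Field E] [NumberField E] [Algebra F E] [Algebra.IsQuadraticExtension F E]
  (c : E ≃ₐ[F] E) {δ : E} (hcδ : c δ = -δ) (hδ : δ ≠ 0) {d : F} (hd : δ * δ = algebraMap F E d)
  (N M : ℕ) {m : ℕ} (e' : Fin N × Fin M ≃ Fin m)

/-- **`toSp` depends on its matrix indices only through their values**: two GR data with equal `T_V, T_W, J_V, J_W`
give the same symplectic automorphism of `𝕎_𝔸` on the same underlying element of `GL_{NM}(𝔸_E)` (pointwise; the proof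
fields are irrelevant) — the embedding `i : U(V) × U(W) → Sp(𝕎)`, `𝕎 = V ⊗ W`.
[cite: GelbartRogawski1991, §3.1 p. 455] [cite: GelbartPiatetskishapiroRallis1987, Part A §2 pp. 7–9] -/
theorem toSp_congr_apply {TV TV' : Matrix (Fin N) (Fin N) F} {TW TW' : Matrix (Fin M) (Fin M) F}
    (hV : TV.IsSymm) (hV' : TV'.IsSymm) (hW : TW.IsSymm) (hW' : TW'.IsSymm)
    {JV JV' : Matrix (Fin N) (Fin N) E} {JW JW' : Matrix (Fin M) (Fin M) E}
    (hJV : JV = TV.map (algebraMap F E)) (hJV' : JV' = TV'.map (algebraMap F E))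
    (hJW : JW = TW.map (algebraMap F E)) (hJW' : JW' = TW'.map (algebraMap F E))
    (eV : TV = TV') (eW : TW = TW') (eJV : JV = JV') (eJW : JW = JW')
    (g : GL (Fin N × Fin M) (AdeleRing (𝓞 E) E)) (hg : g ∈ UnitaryGroup.adelicPair F E c N M JV JW)
    (hg' : g ∈ UnitaryGroup.adelicPair F E c N M JV' JW')
    (v : (Fin m → AdeleRing (𝓞 F) F) × (Fin m → AdeleRing (𝓞 F) F)) :
    (toSp F E c N M e' JV JW hcδ hδ hd hV hW hJV hJW ⟨g, hg⟩ :
        symplecticGroup (polar (adelicForm F (Fin m) (adelicGram F e' TV TW)))).1 v =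
      (toSp F E c N M e' JV' JW' hcδ hδ hd hV' hW' hJV' hJW' ⟨g, hg'⟩ :
        symplecticGroup (polar (adelicForm F (Fin m) (adelicGram F e' TV' TW')))).1 v := by
  subst eV eW eJV eJW
  rfl

end Congr

/-! ## §3 The doubled CM pair splitting at `𝕋` -/

section Splitting

variable (L : Type) [Field L] [NumberField L] [IsCMField L] {N n : ℕ} (e : Fin N × Fin 1 ≃ Fin n)
  (dV : Fin N → L) (hdV : ∀ i, IsCMField.complexConj L (dV i) = dV i) (hdV0 : ∀ i, dV i ≠ 0)
  (dW : Fin 1 → L) (hdW : ∀ i, IsCMField.complexConj L (dW i) = dW i) (hdW0 : ∀ i, dW i ≠ 0)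

/-- **the splitting package transported along a VARIABLE Gram matrix** (`subst`): a homomorphism at Gram `T'`
with the projection of `s'(p)` (pointwise on `𝕎_𝔸`), the coefficient-continuity of `u ↦ s'(1,u)` and the transported
domination hypothesis. [cite: GelbartRogawski1991, §3.1 Prop. 3.1.1 p. 455] -/
private theorem package_of_gram_eq {M' m : ℕ} (e' : Fin N × Fin M' ≃ Fin m) (dW' : Fin M' → L)
    (hdW' : ∀ i, IsCMField.complexConj L (dW' i) = dW' i) (hdW'0 : ∀ i, dW' i ≠ 0)
    (hGR : (cmSplittingDatum L e' dV hdV hdV0 dW' hdW' hdW'0).CompatibleSplitting)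
    (hdom : ∀ (q : adelicMpCont (↥(maximalRealSubfield L)) (Fin m)
        (adelicGram (↥(maximalRealSubfield L)) e' (realDiagonal L dV hdV) (realDiagonal L dW' hdW')))
      (Φ : piSchwartzBruhat (↥(maximalRealSubfield L)) (Fin m))
      (C : Set ↥(UnitaryGroup.adelic (↥(maximalRealSubfield L)) L (IsCMField.complexConj L) M' (Matrix.diagonal dW'))),
      IsCompact C →
        ∃ Φ₀ : (Fin m → AdeleRing (𝓞 ↥(maximalRealSubfield L)) ↥(maximalRealSubfield L)) → ℂ,
          Φ₀ ∈ piSchwartzBruhat (↥(maximalRealSubfield L)) (Fin m) ∧ (∀ x, (Φ₀ x).im = 0 ∧ 0 ≤ (Φ₀ x).re) ∧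
            ∀ u ∈ C, ∀ x, ‖((adelicMpCont.omega (↥(maximalRealSubfield L)) (Fin m) _
              (q * cmPairSplitting L e' dV hdV hdV0 dW' hdW' hdW'0 hGR (1, u) * q⁻¹) Φ :
                piSchwartzBruhat (↥(maximalRealSubfield L)) (Fin m)) :
                  (Fin m → AdeleRing (𝓞 ↥(maximalRealSubfield L)) ↥(maximalRealSubfield L)) → ℂ) x‖ ≤ (Φ₀ x).re)
    {T' : Matrix (Fin m) (Fin m) (AdeleRing (𝓞 ↥(maximalRealSubfield L)) ↥(maximalRealSubfield L))}
    (hTe : adelicGram (↥(maximalRealSubfield L)) e' (realDiagonal L dV hdV) (realDiagonal L dW' hdW') = T') :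
    ∃ s' : ↥(UnitaryGroup.adelic (↥(maximalRealSubfield L)) L (IsCMField.complexConj L) N (Matrix.diagonal dV)) ×
          ↥(UnitaryGroup.adelic (↥(maximalRealSubfield L)) L (IsCMField.complexConj L) M' (Matrix.diagonal dW')) →*
        adelicMpCont (↥(maximalRealSubfield L)) (Fin m) T',
      (∀ (p : ↥(UnitaryGroup.adelic (↥(maximalRealSubfield L)) L (IsCMField.complexConj L) N (Matrix.diagonal dV)) ×
          ↥(UnitaryGroup.adelic (↥(maximalRealSubfield L)) L (IsCMField.complexConj L) M' (Matrix.diagonal dW')))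
        (v : (Fin m → AdeleRing (𝓞 ↥(maximalRealSubfield L)) ↥(maximalRealSubfield L)) ×
          (Fin m → AdeleRing (𝓞 ↥(maximalRealSubfield L)) ↥(maximalRealSubfield L))),
        (adelicMpCont.proj (↥(maximalRealSubfield L)) (Fin m) T' (s' p)).1 v =
          (toSp (↥(maximalRealSubfield L)) L (IsCMField.complexConj L) N M' e' (Matrix.diagonal dV)
            (Matrix.diagonal dW') (complexConj_imagUnit L) (imagUnit_ne_zero L) (imagUnit_mul_self L)
            (realDiagonal_isSymm L dV hdV) (realDiagonal_isSymm L dW' hdW')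
            (realDiagonal_map L dV hdV).symm (realDiagonal_map L dW' hdW').symm
            (UnitaryGroup.adelicInl _ L _ N M' _ _ p.1 * UnitaryGroup.adelicInr _ L _ N M' _ _ p.2) :
              symplecticGroup (polar (adelicForm (↥(maximalRealSubfield L)) (Fin m)
                (adelicGram (↥(maximalRealSubfield L)) e' (realDiagonal L dV hdV) (realDiagonal L dW' hdW'))))).1 v) ∧
      (Continuous fun u : ↥(UnitaryGroup.adelic (↥(maximalRealSubfield L)) L (IsCMField.complexConj L) M'
          (Matrix.diagonal dW')) =>
        ((s' (1, u) : adelicMpCont (↥(maximalRealSubfield L)) (Fin m) T') :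
          adelicMp (↥(maximalRealSubfield L)) (Fin m) T')) ∧
      ∀ (q : adelicMpCont (↥(maximalRealSubfield L)) (Fin m) T') (Φ : piSchwartzBruhat (↥(maximalRealSubfield L)) (Fin m))
        (C : Set ↥(UnitaryGroup.adelic (↥(maximalRealSubfield L)) L (IsCMField.complexConj L) M' (Matrix.diagonal dW'))),
        IsCompact C →
        ∃ Φ₀ : (Fin m → AdeleRing (𝓞 ↥(maximalRealSubfield L)) ↥(maximalRealSubfield L)) → ℂ,
          Φ₀ ∈ piSchwartzBruhat (↥(maximalRealSubfield L)) (Fin m) ∧ (∀ x, (Φ₀ x).im = 0 ∧ 0 ≤ (Φ₀ x).re) ∧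
            ∀ u ∈ C, ∀ x, ‖((adelicMpCont.omega (↥(maximalRealSubfield L)) (Fin m) T' (q * s' (1, u) * q⁻¹) Φ :
              piSchwartzBruhat (↥(maximalRealSubfield L)) (Fin m)) :
                (Fin m → AdeleRing (𝓞 ↥(maximalRealSubfield L)) ↥(maximalRealSubfield L)) → ℂ) x‖ ≤ (Φ₀ x).re := by
  subst hTe
  refine ⟨cmPairSplitting L e' dV hdV hdV0 dW' hdW' hdW'0 hGR, fun p v => ?_, ?_, fun q Φ C hC => hdom q Φ C hC⟩
  · exact congrArg (fun g : symplecticGroup (polar (adelicForm (↥(maximalRealSubfield L)) (Fin m)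
        (adelicGram (↥(maximalRealSubfield L)) e' (realDiagonal L dV hdV) (realDiagonal L dW' hdW')))) => g.1 v)
      (proj_pairSplitting (↥(maximalRealSubfield L)) L (IsCMField.complexConj L) N M' e' (Matrix.diagonal dV)
        (Matrix.diagonal dW') (complexConj_imagUnit L) (imagUnit_ne_zero L) (imagUnit_mul_self L)
        (realDiagonal_isSymm L dV hdV) (realDiagonal_isSymm L dW' hdW')
        (isUnit_det_realDiagonal L dV hdV hdV0) (isUnit_det_realDiagonal L dW' hdW' hdW'0)
        (realDiagonal_map L dV hdV).symm (realDiagonal_map L dW' hdW').symm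
        (splittingOf_isCompatible _ _ _ _ _ _ _ _ _ _ _ _ _ _ _ _ _ hGR) p)
  · exact continuous_subtype_val.comp
      ((continuous_pairSplitting (↥(maximalRealSubfield L)) L (IsCMField.complexConj L) N M' e'
        (Matrix.diagonal dV) (Matrix.diagonal dW')
        (continuous_splittingOf _ _ _ _ _ _ _ _ _ _ _ _ _ _ _ _ _ hGR)).comp (continuous_const.prodMk continuous_id))

end Splitting

/-! ## §4 The package consumed by the Siegel–Weil boundedness assembly -/

section Package

variable (L : Type) [Field L] [NumberField L] [IsCMField L] {N n : ℕ} (e : Fin N × Fin 1 ≃ Fin n)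
  (dV : Fin N → L) (hdV : ∀ i, IsCMField.complexConj L (dV i) = dV i) (hdV0 : ∀ i, dV i ≠ 0)
  (dW : Fin 1 → L) (hdW : ∀ i, IsCMField.complexConj L (dW i) = dW i) (hdW0 : ∀ i, dW i ≠ 0)

include hdV0 hdW0 in
/-- **The doubled CM pair splitting at `𝕋`.**  There is a homomorphism
`s' : U(diag d_V)(𝔸) × U(diag(d_W 0, −d_W 0))(𝔸) →* Mp_ψ(𝕎□_𝔸)ᶜᵒⁿᵗ` at the doubled Gram matrix
`𝕋 = doubledGramFin (adelicGram e (diag d_V) (diag d_W))` (the compatible pair splitting of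
[GelbartRogawski1991, Prop. 3.1.1] for the doubled pair, ★ `GRConstruction.compatibleSplitting_cmSplittingDatum`,
transported along `adelicGram_eD_doubledLine`) such that: (i) the projection of `s'(1, u)` is, POINTWISE on `𝕎□_𝔸`,
the pair embedding `toSp` of the doubled pair in the child line's conventions (`J = T.map ι`, `hJ := rfl`, carrier
`U(T_W ⊕ −T_W)`) at `1 ⊗ u`; (ii) `u ↦ s'(1, u)` is coefficient-continuous; (iii) for every FIXED
`q ∈ Mp_ψ(𝕎□_𝔸)ᶜᵒⁿᵗ`, every `Φ` and every compact `C`, ONE real non-negative `Φ₀ ∈ 𝒮(𝔸^{n+n})` dominates all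
`ω(q · s'(1,u) · q⁻¹)Φ`, `u ∈ C` — Weil's Lemme 5 in the conjugated polarisation, no sign hypothesis
(★ `Weil1964.exists_piSchwartzBruhat_dominating_conj_cmPairSplitting_inr_two`).
[cite: GelbartRogawski1991, §3.1 Prop. 3.1.1 p. 455] [cite: Weil1964, Chap. III n° 41, Lemme 5 p. 194]
[cite: Weil1965, Chap. V n° 47, n° 50] -/
theorem exists_doubledPairSplitting :
    ∃ s' : ↥(UnitaryGroup.adelic (↥(maximalRealSubfield L)) L (IsCMField.complexConj L) N (Matrix.diagonal dV)) ×
          ↥(UnitaryGroup.adelic (↥(maximalRealSubfield L)) L (IsCMField.complexConj L) 2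
            (Matrix.diagonal ![dW 0, -dW 0])) →*
        adelicMpCont (↥(maximalRealSubfield L)) (Fin (n + n))
          (doubledGramFin (↥(maximalRealSubfield L))
            (adelicGram (↥(maximalRealSubfield L)) e (realDiagonal L dV hdV) (realDiagonal L dW hdW))),
      (∀ (u : ↥(UnitaryGroup.adelic (↥(maximalRealSubfield L)) L (IsCMField.complexConj L) 2
          (Matrix.diagonal ![dW 0, -dW 0])))
        (hu : (u : GL (Fin (1 + 1)) (AdeleRing (𝓞 L) L)) ∈
          UnitaryGroup.adelic (↥(maximalRealSubfield L)) L (IsCMField.complexConj L) (1 + 1)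
            ((TWD (↥(maximalRealSubfield L)) (realDiagonal L dW hdW)).map (algebraMap (↥(maximalRealSubfield L)) L)))
        (v : (Fin (n + n) → AdeleRing (𝓞 ↥(maximalRealSubfield L)) ↥(maximalRealSubfield L)) ×
          (Fin (n + n) → AdeleRing (𝓞 ↥(maximalRealSubfield L)) ↥(maximalRealSubfield L))),
        (adelicMpCont.proj (↥(maximalRealSubfield L)) (Fin (n + n)) _ (s' (1, u))).1 v =
          (toSp (↥(maximalRealSubfield L)) L (IsCMField.complexConj L) N (1 + 1) (eD N e)
            ((realDiagonal L dV hdV).map (algebraMap (↥(maximalRealSubfield L)) L))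
            ((TWD (↥(maximalRealSubfield L)) (realDiagonal L dW hdW)).map (algebraMap (↥(maximalRealSubfield L)) L))
            (complexConj_imagUnit L) (imagUnit_ne_zero L) (imagUnit_mul_self L) (realDiagonal_isSymm L dV hdV)
            (TWD_isSymm (↥(maximalRealSubfield L)) (realDiagonal L dW hdW) (realDiagonal_isSymm L dW hdW)) rfl rfl
            (UnitaryGroup.adelicInr (↥(maximalRealSubfield L)) L (IsCMField.complexConj L) N (1 + 1) _ _ ⟨u, hu⟩) :
            symplecticGroup (polar (adelicForm (↥(maximalRealSubfield L)) (Fin (n + n))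
              (adelicGram (↥(maximalRealSubfield L)) (eD N e) (realDiagonal L dV hdV)
                (TWD (↥(maximalRealSubfield L)) (realDiagonal L dW hdW)))))).1 v) ∧
      (Continuous fun u : ↥(UnitaryGroup.adelic (↥(maximalRealSubfield L)) L (IsCMField.complexConj L) 2
          (Matrix.diagonal ![dW 0, -dW 0])) =>
        ((s' (1, u) : adelicMpCont (↥(maximalRealSubfield L)) (Fin (n + n)) _) :
          adelicMp (↥(maximalRealSubfield L)) (Fin (n + n))
            (doubledGramFin (↥(maximalRealSubfield L))
              (adelicGram (↥(maximalRealSubfield L)) e (realDiagonal L dV hdV) (realDiagonal L dW hdW))))) ∧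
      ∀ (q : adelicMpCont (↥(maximalRealSubfield L)) (Fin (n + n))
          (doubledGramFin (↥(maximalRealSubfield L))
            (adelicGram (↥(maximalRealSubfield L)) e (realDiagonal L dV hdV) (realDiagonal L dW hdW))))
        (Φ : piSchwartzBruhat (↥(maximalRealSubfield L)) (Fin (n + n)))
        (C : Set ↥(UnitaryGroup.adelic (↥(maximalRealSubfield L)) L (IsCMField.complexConj L) 2
          (Matrix.diagonal ![dW 0, -dW 0]))), IsCompact C →
        ∃ Φ₀ : (Fin (n + n) → AdeleRing (𝓞 ↥(maximalRealSubfield L)) ↥(maximalRealSubfield L)) → ℂ,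
          Φ₀ ∈ piSchwartzBruhat (↥(maximalRealSubfield L)) (Fin (n + n)) ∧ (∀ x, (Φ₀ x).im = 0 ∧ 0 ≤ (Φ₀ x).re) ∧
            ∀ u ∈ C, ∀ x, ‖((adelicMpCont.omega (↥(maximalRealSubfield L)) (Fin (n + n)) _
              (q * s' (1, u) * q⁻¹) Φ : piSchwartzBruhat (↥(maximalRealSubfield L)) (Fin (n + n))) :
                (Fin (n + n) → AdeleRing (𝓞 ↥(maximalRealSubfield L)) ↥(maximalRealSubfield L)) → ℂ) x‖ ≤
              (Φ₀ x).re := by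
  have hGR := GRConstruction.compatibleSplitting_cmSplittingDatum L (eD N e) dV hdV hdV0 (![dW 0, -dW 0])
    (complexConj_doubledLine L dW hdW) (doubledLine_ne_zero L dW hdW0)
  have hTe := adelicGram_eD_doubledLine L e dV hdV dW hdW
  -- (`have` first: an inline `obtain … := package_of_gram_eq …` makes `generalize` re-check the whole goal)
  have pkg := package_of_gram_eq L dV hdV hdV0 (eD N e) _ _ _ hGR
    (fun q Φ C hC => exists_piSchwartzBruhat_dominating_conj_cmPairSplitting_inr_two L (eD N e) dV hdV hdV0 _
      (complexConj_doubledLine L dW hdW) (doubledLine_ne_zero L dW hdW0) hGR q Φ hC) hTe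
  obtain ⟨s', hproj, hcont, hdom⟩ := pkg
  refine ⟨s', fun u hu v => ?_, hcont, hdom⟩
  have h1 : UnitaryGroup.adelicInl (↥(maximalRealSubfield L)) L (IsCMField.complexConj L) N 2 (Matrix.diagonal dV)
        (Matrix.diagonal ![dW 0, -dW 0])
        ((1, u) : ↥(UnitaryGroup.adelic (↥(maximalRealSubfield L)) L (IsCMField.complexConj L) N (Matrix.diagonal dV)) ×
          ↥(UnitaryGroup.adelic (↥(maximalRealSubfield L)) L (IsCMField.complexConj L) 2
            (Matrix.diagonal ![dW 0, -dW 0]))).1 *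
      UnitaryGroup.adelicInr (↥(maximalRealSubfield L)) L (IsCMField.complexConj L) N 2 (Matrix.diagonal dV)
        (Matrix.diagonal ![dW 0, -dW 0])
        ((1, u) : ↥(UnitaryGroup.adelic (↥(maximalRealSubfield L)) L (IsCMField.complexConj L) N (Matrix.diagonal dV)) ×
          ↥(UnitaryGroup.adelic (↥(maximalRealSubfield L)) L (IsCMField.complexConj L) 2
            (Matrix.diagonal ![dW 0, -dW 0]))).2 =
      UnitaryGroup.adelicInr (↥(maximalRealSubfield L)) L (IsCMField.complexConj L) N 2 (Matrix.diagonal dV)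
        (Matrix.diagonal ![dW 0, -dW 0]) u := by
    show UnitaryGroup.adelicInl (↥(maximalRealSubfield L)) L (IsCMField.complexConj L) N 2 (Matrix.diagonal dV)
        (Matrix.diagonal ![dW 0, -dW 0]) 1 * _ = _
    rw [map_one, one_mul]
  -- the underlying `GL_{2N}(𝔸_L)` element of `1 ⊗ u` is the same in both carriers
  have hval : ((UnitaryGroup.adelicInr (↥(maximalRealSubfield L)) L (IsCMField.complexConj L) N (1 + 1)
        ((realDiagonal L dV hdV).map (algebraMap (↥(maximalRealSubfield L)) L))
        ((TWD (↥(maximalRealSubfield L)) (realDiagonal L dW hdW)).map (algebraMap (↥(maximalRealSubfield L)) L))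
        ⟨u, hu⟩ : UnitaryGroup.adelicPair (↥(maximalRealSubfield L)) L (IsCMField.complexConj L) N (1 + 1) _ _) :
          GL (Fin N × Fin (1 + 1)) (AdeleRing (𝓞 L) L)) =
      ((UnitaryGroup.adelicInr (↥(maximalRealSubfield L)) L (IsCMField.complexConj L) N 2 (Matrix.diagonal dV)
        (Matrix.diagonal ![dW 0, -dW 0]) u :
          UnitaryGroup.adelicPair (↥(maximalRealSubfield L)) L (IsCMField.complexConj L) N 2 _ _) :
          GL (Fin N × Fin 2) (AdeleRing (𝓞 L) L)) :=
    Units.ext (by rw [UnitaryGroup.coe_adelicInr, UnitaryGroup.coe_adelicInr])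
  have hmem : ((UnitaryGroup.adelicInr (↥(maximalRealSubfield L)) L (IsCMField.complexConj L) N 2 (Matrix.diagonal dV)
        (Matrix.diagonal ![dW 0, -dW 0]) u :
          UnitaryGroup.adelicPair (↥(maximalRealSubfield L)) L (IsCMField.complexConj L) N 2 _ _) :
          GL (Fin N × Fin 2) (AdeleRing (𝓞 L) L)) ∈
      UnitaryGroup.adelicPair (↥(maximalRealSubfield L)) L (IsCMField.complexConj L) N (1 + 1)
        ((realDiagonal L dV hdV).map (algebraMap (↥(maximalRealSubfield L)) L))
        ((TWD (↥(maximalRealSubfield L)) (realDiagonal L dW hdW)).map (algebraMap (↥(maximalRealSubfield L)) L)) :=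
    hval ▸ (UnitaryGroup.adelicInr (↥(maximalRealSubfield L)) L (IsCMField.complexConj L) N (1 + 1) _ _ ⟨u, hu⟩).2
  have hsub : UnitaryGroup.adelicInr (↥(maximalRealSubfield L)) L (IsCMField.complexConj L) N (1 + 1)
        ((realDiagonal L dV hdV).map (algebraMap (↥(maximalRealSubfield L)) L))
        ((TWD (↥(maximalRealSubfield L)) (realDiagonal L dW hdW)).map (algebraMap (↥(maximalRealSubfield L)) L))
        ⟨u, hu⟩ = ⟨_, hmem⟩ := Subtype.ext hval
  rw [hproj (1, u) v, h1, hsub]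
  exact toSp_congr_apply (↥(maximalRealSubfield L)) L (IsCMField.complexConj L) (complexConj_imagUnit L)
    (imagUnit_ne_zero L) (imagUnit_mul_self L) N 2 (eD N e) (realDiagonal_isSymm L dV hdV) (realDiagonal_isSymm L dV hdV)
    (realDiagonal_isSymm L _ (complexConj_doubledLine L dW hdW))
    (TWD_isSymm (↥(maximalRealSubfield L)) (realDiagonal L dW hdW) (realDiagonal_isSymm L dW hdW))
    (realDiagonal_map L dV hdV).symm (rfl) (realDiagonal_map L _ (complexConj_doubledLine L dW hdW)).symm (rfl)
    rfl (realDiagonal_doubledLine L dW hdW) (realDiagonal_map L dV hdV).symm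
    (map_TWD_realDiagonal L dW hdW).symm _
    (UnitaryGroup.adelicInr (↥(maximalRealSubfield L)) L (IsCMField.complexConj L) N 2 (Matrix.diagonal dV)
      (Matrix.diagonal ![dW 0, -dW 0]) u).2 hmem v

end Package

end Literature.NumberTheory.Li1992.DoubledPair

end
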